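import Mathlib
import Summits.NavierStokesRegularity.NavierStokesRegularity.Theses.SubcriticalEnvelope
import Summits.NavierStokesRegularity.NavierStokesRegularity.Theorems.SubcriticalEnvelopeEnvelopeSmoothingViscous
import HarnessLib

/-!
# `SubcriticalEnvelope.ViscousEnvelopeSmoothing` (stmt-NavierStokesRegularity-26132) — closed by name

The route item `ViscousEnvelopeSmoothing` (support B‴ of route `SubcriticalEnvelope`, rev 4) is,
verbatim, the statement of the landed theorem
`Summit.NavierStokesRegularity.NavierStokesRegularity.Theorems.SubcriticalEnvelopeEnvelopeSmoothingViscous.envelopeSmoothing_viscousFamily`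
(p593538): for a comparable table `α ∈ E₂(R)`, a one-shell datum `X₀`, a scale ratio `1+ε₀`
(`ε₀ > 0`), a margin `η > 0` and a viscosity `ν > 0`, a window-wise subcritical tail-energy envelope
(`∀ T ∃ C`, over all honest `ν`-viscous lattice solutions on the sub-windows `[0,s] ⊆ [0,T]`) yields a
global regular solution of the `ν`-viscous cascade lattice (`ViscousGlobal ε₀ ν α X₀`).  The engine
is the Literature theorem
`Literature.Analysis.FluidPDE.TaoCascade.exists_viscousGlobal_of_subcriticalEnvelope_of_inTableClass`
(damped Picard local theory + continuation under the a-priori envelope; Barbato–Morandin–Romito 2011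
§3.2 bootstrap, sign-free, `m = 4`).

HONEST FRAMING: MODEL lattice ODEs only (Tao 2016 §4, the rung TL-M2Break lattice); nothing in this
file is a statement about the Navier–Stokes equations or their regularity.
-/

set_option linter.dupNamespace false

namespace Summit.NavierStokesRegularity.NavierStokesRegularity.Theorems

/-- **Viscous envelope smoothing** (route item `SubcriticalEnvelope.ViscousEnvelopeSmoothing`,
stmt-NavierStokesRegularity-26132): a window-wise subcritical tail-energy envelope for the honest
`ν`-viscous cascade lattice from a one-shell datum on a comparable table gives a global regular
viscous solution.  Closed by name: the item is verbatim the landed theorem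
`SubcriticalEnvelopeEnvelopeSmoothingViscous.envelopeSmoothing_viscousFamily` (p593538).
MODEL lattice only; no Navier–Stokes statement is proved here. -/
theorem subcriticalEnvelope_viscousEnvelopeSmoothing_proof :
    Summit.NavierStokesRegularity.NavierStokesRegularity.Theses.SubcriticalEnvelope.ViscousEnvelopeSmoothing := by
  unfold Summit.NavierStokesRegularity.NavierStokesRegularity.Theses.SubcriticalEnvelope.ViscousEnvelopeSmoothing
  exact SubcriticalEnvelopeEnvelopeSmoothingViscous.envelopeSmoothing_viscousFamily

end Summit.NavierStokesRegularity.NavierStokesRegularity.Theorems
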